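import Mathlib
import Summits.BirchSwinnertonDyer.BirchSwinnertonDyer.Theorems.EisensteinPrimesMazurMCOnX1RankZeroTameSeam
import HarnessLib

/-!
# Sketch (utd-idea g38) — crux idea `thin-comb-reflection` on the WALL
`UniversalToricDescent.AdditiveSplitIMCInclusionAtThree` (stmt-BirchSwinnertonDyer-20395)

First checkable statements of the line (an IDEA sketch, not a registered skeleton; NO `sorry`; every
arithmetic input is a field of a hypothesis structure, NOTHING asserted; BSD is not proved here).

Coordinates. `Λ₂(O) = O⟦T₂⟧⟦T₁⟧ = PowerSeries (PowerSeries O)` (tree convention of `IwasawaAlgebra₂`),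
OUTER `T₁ = γ_𝔭 − 1`, INNER `T₂ = γ_𝔭' − 1` for a generator pair of `Gal(K̃_∞/K) ≅ ℤ₃²` with `γ_𝔭'` fixing
the `𝔭`-ramified `ℤ₃`-extension `K_∞^{(𝔭)}` and `γ_𝔭` fixing `K_∞^{(𝔭')}`; `c γ_𝔭 c = γ_𝔭'`.
* the `𝔭`-AXIS (CM branch `𝛉^{(𝔭)}`, whose Beilinson–Flach classes bound `X_{∅,0}` = relaxed at `𝔭`,
  strict at `𝔭'`) is the line `T₂ = 0`;
* the THIN COMB is the set of its finite-order translates `T₂ = ζ − 1`, `ζ ∈ μ_{3^∞}` (the `𝔭`-axes of the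
  3-power Dirichlet twists `f_E ⊗ φ̄`; all inside the one `Λ₂`-module `X₂ = X_{∅,0}(E/K̃_∞)`); these are
  the ONLY lines carrying Euler-system classes when `3 ∣ N` is additive (`U₃ f_E = 0`: no `Λ`-adic
  interpolation transverse to the CM-family direction, memo v32 D3);
* the ANTICYCLOTOMIC line is `(1 + T₁)(1 + T₂) = 1`; it carries NO classes (TraceZero barrier) and is
  fixed pointwise by the REFLECTION `ρ : γ ↦ c γ⁻¹ c`, i.e. `1 + T₁ ↦ (1 + T₂)⁻¹`, `1 + T₂ ↦ (1 + T₁)⁻¹`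
  (Büyükboduk–Lei's `τ`, arXiv:1707.00557 Def. 3.8).

§1 types the pure-algebra lever (THIN-COMB + REFLECTION RIGIDITY, two doors) and PROVES the blind-spot
witness showing the reflection (or μ) door is necessary; §2 PROVES the assembly
`rigidity + comb package ⟹ rational wall shape` over abstract carriers.
-/

set_option autoImplicit false
set_option linter.dupNamespace false

namespace Summit.BirchSwinnertonDyer.BirchSwinnertonDyer.Cruxes.AdditiveSplitIMCInclusionAtThree.CombReflection

open Polynomial Finset

/-! ## §1 Thin combs, reflection, rigidity (pure algebra over a coefficient ring `O`) -/

section Algebra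

variable (O : Type*) [CommRing O]

/-- `Λ₂(O) = O⟦T₂⟧⟦T₁⟧`. For `O = ℤ_[p]` this is the tree's `IwasawaAlgebra₂ p` by `rfl`. -/
abbrev Λ₂ : Type _ := PowerSeries (PowerSeries O)

/-- Outer variable `T₁ = γ_𝔭 − 1`. -/
noncomputable def T₁ : Λ₂ O := PowerSeries.X

/-- Inner variable `T₂ = γ_𝔭' − 1`. -/
noncomputable def T₂ : Λ₂ O := PowerSeries.C (PowerSeries.X (R := O))

/-- Constants `O → Λ₂(O)`. -/
noncomputable def const : O →+* Λ₂ O := (PowerSeries.C (R := PowerSeries O)).comp (PowerSeries.C (R := O))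

/-- The comb line through the inner point `y`: the height-one prime `T₂ − y` (a VERTICAL prime in the
coordinates of the tree's qtame sketch on crux 20728). -/
noncomputable def combLine (y : O) : Λ₂ O := PowerSeries.C (PowerSeries.X - PowerSeries.C y)

variable {O}

/-- Base change of coefficients `Λ₂(O) → Λ₂(O')`. -/
noncomputable def baseChange {O' : Type*} [CommRing O'] (φ : O →+* O') : Λ₂ O →+* Λ₂ O' :=
  PowerSeries.map (PowerSeries.map φ)

/-- **`G` divides `s • F` on the comb line `T₂ = y`**: `s·F ∈ (G, T₂ − y)`, i.e. divisibility in the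
domain `Λ₂(O')/(T₂ − y) ≅ O'⟦T₁⟧` with slack `s` (`s = 1`: integral; `s = p^t`: rational). No evaluation
map is needed. -/
def LineDvdUpTo {O' : Type*} [CommRing O'] (y : O') (G F : Λ₂ O') (s : O') : Prop :=
  const O' s * F ∈ Ideal.span ({G, combLine O' y} : Set (Λ₂ O'))

variable (O) (p : ℕ)

/-- **Integral thin-comb divisibility**: for roots of unity `ζ` of UNBOUNDED 𝑝-power order (in any
`O`-algebra domain holding them), `G ∣ F` on the line `T₂ = ζ − 1`. -/
def ThinCombDvdInt (G F : Λ₂ O) : Prop :=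
  ∀ n : ℕ, ∃ m : ℕ, n ≤ m ∧ ∀ (O' : Type) [CommRing O'] [IsDomain O'] [Algebra O O'] (ζ : O'),
    IsPrimitiveRoot ζ (p ^ (m + 1)) →
      LineDvdUpTo (ζ - 1) (baseChange (algebraMap O O') G) (baseChange (algebraMap O O') F) 1

/-- **Rational thin-comb divisibility**: the same with a line-dependent slack `p^t`. This is the shape ONE
Beilinson–Flach/Kolyvagin-system argument per comb line delivers (card K2). -/
def ThinCombDvdRat (G F : Λ₂ O) : Prop :=
  ∀ n : ℕ, ∃ m : ℕ, n ≤ m ∧ ∀ (O' : Type) [CommRing O'] [IsDomain O'] [Algebra O O'] (ζ : O'),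
    IsPrimitiveRoot ζ (p ^ (m + 1)) → ∃ t : ℕ,
      LineDvdUpTo (ζ - 1) (baseChange (algebraMap O O') G) (baseChange (algebraMap O O') F) ((p : O') ^ t)

/-- **`μ = 0` along the thin comb** (door M): on comb lines of unbounded order no NON-UNIT constant divides
`F`, i.e. `μ(F|_{T₂ = ζ−1}) = 0`. -/
def ThinCombMuZero (F : Λ₂ O) : Prop :=
  ∀ n : ℕ, ∃ m : ℕ, n ≤ m ∧ ∀ (O' : Type) [CommRing O'] [IsDomain O'] [Algebra O O'] (ζ : O'),
    IsPrimitiveRoot ζ (p ^ (m + 1)) → ∀ c : O', ¬ IsUnit c →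
      ¬ LineDvdUpTo (ζ - 1) (const O' c) (baseChange (algebraMap O O') F) 1

/-- **A reflection of `Λ₂(O)`**: an `O`-linear ring automorphism with `1 + ρ(T₁) = (1 + T₂)⁻¹`,
`1 + ρ(T₂) = (1 + T₁)⁻¹` — the substitution `γ ↦ c γ⁻¹ c` (c swaps `γ_𝔭, γ_𝔭'`), which FIXES THE
ANTICYCLOTOMIC LINE `(1+T₁)(1+T₂) = 1` pointwise and maps the comb line `T₂ = ζ − 1` to the transverse
line `T₁ = ζ⁻¹ − 1`. (Existence: `PowerSeries`/`MvPowerSeries` substitution; not constructed here.)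
[cite: arXiv:1707.00557, Def. 3.8 (the involution `τ : γ_𝔭 ↦ γ_{𝔭^c}⁻¹`)] -/
def IsReflection (ρ : Λ₂ O ≃+* Λ₂ O) : Prop :=
  (1 + T₂ O) * (1 + ρ (T₁ O)) = 1 ∧ (1 + T₁ O) * (1 + ρ (T₂ O)) = 1 ∧ ∀ c : O, ρ (const O c) = const O c

/-- **THIN-COMB + REFLECTION RIGIDITY, rational form (the lever; card K1).** If `G` and `F` are each
`ρ`-symmetric up to a unit and `G ∣ p^{t_ζ} F` on comb lines of unbounded order, then `G ∣ p^a F` in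
`Λ₂(O)`. TRUE for `O` a complete DVR (`ℤ_[p]`, `W(𝔽̄_p)`, finite extensions): prime by prime over the
UFD `O⟦T₁,T₂⟧` — a prime `P ∤ p` of `G` is either VISIBLE on the comb (Weierstrass degree `≥ 1` on
infinitely many comb lines ⇒ shares infinitely many zeros with `F` ⇒ `P ∣ F`, since `(P, F)` has height
2) or INVISIBLE (`P|_{T₂=ζ−1} = c_ζ·unit` for all `ζ` of large order ⟺ the `T₁^0`-coefficient of `P` is
lexicographically `(μ, λ)`-minimal); a prime invisible on BOTH the `T₂`-comb and the `T₁`-comb is `∼ p`,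
and `ρ` exchanges the two combs, so `ρ(P) ∣ ρ(G) ∼ G` is visible, `ρ(P) ∣ F`, `P ∣ ρ⁻¹F ∼ F`. The power
of `p` is lost to the slack. Thin comb ALONE is not enough: `blindSpot_*` below. -/
def CombReflectionRigidityRat : Prop :=
  ∀ ρ : Λ₂ O ≃+* Λ₂ O, IsReflection O ρ → ∀ G F : Λ₂ O,
    Associated (ρ G) G → Associated (ρ F) F → ThinCombDvdRat O p G F →
      ∃ a : ℕ, G ∣ const O ((p : O) ^ a) * F

/-- **Integral form**: with integral comb divisibility on lines of unbounded order the power of `p` is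
also detected (`p^m ∣ F|_{T₂=ζ−1}` for `ord ζ → ∞` forces `μ_i(F) ≥ m` coefficientwise), so `G ∣ F`. -/
def CombReflectionRigidityInt : Prop :=
  ∀ ρ : Λ₂ O ≃+* Λ₂ O, IsReflection O ρ → ∀ G F : Λ₂ O,
    Associated (ρ G) G → Associated (ρ F) F → ThinCombDvdInt O p G F → G ∣ F

/-- **Door M (no reflection)**: integral thin comb + `μ(F|_{line}) = 0` on the comb ⟹ `G ∣ F`
(an invisible `P ∣ G` forces a non-unit constant `c_ζ ∣ F|_{line}`, contradicting `μ = 0`). Needs the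
INTEGRAL comb: with slack `p^t` an invisible factor can hide inside the slack. -/
def CombMuRigidityInt : Prop :=
  ∀ G F : Λ₂ O, ThinCombDvdInt O p G F → ThinCombMuZero O p F → G ∣ F

/-! ### Proved sanity: two-variable divisibility ⟹ comb divisibility (the trivial direction) -/

omit [CommRing O] in
theorem lineDvdUpTo_of_dvd {O' : Type*} [CommRing O'] (y : O') {G F : Λ₂ O'} (h : G ∣ F) (s : O') :
    LineDvdUpTo y G F s := by
  obtain ⟨q, rfl⟩ := h
  unfold LineDvdUpTo
  have hG : G ∈ Ideal.span ({G, combLine O' y} : Set (Λ₂ O')) := Ideal.subset_span (by simp)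
  simpa [mul_comm, mul_assoc] using Ideal.mul_mem_left _ (const O' s * q) hG

theorem thinCombDvdInt_of_dvd {G F : Λ₂ O} (h : G ∣ F) : ThinCombDvdInt O p G F := by
  intro n
  refine ⟨n, le_rfl, fun O' _ _ _ ζ _ => ?_⟩
  exact lineDvdUpTo_of_dvd (ζ - 1) (map_dvd _ h) 1

/-! ### Proved: the BLIND SPOT of the thin comb (why a second door is necessary)
`G₀ = T₂` divides `F₀ = p` INTEGRALLY on EVERY comb line (`T₂ ↦ ζ − 1`, and `ζ − 1 ∣ p`), yet
`T₂ ∤ p^{a+1}` in `Λ₂`; and `T₂` is NOT `ρ`-symmetric (`ρ T₂ = (1+T₁)⁻¹ − 1`), so the witness violates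
exactly the reflection hypothesis (and the `μ = 0` hypothesis: `μ(p) > 0`). One dimension down this is the
FULLRANGE-SHADOW phenomenon (B-g33-1); it is the critic's `(T₁T₂ + p)`-type witness on crux 20728 in its
simplest form. -/

theorem baseChange_T₂ {O' : Type*} [CommRing O'] (φ : O →+* O') : baseChange φ (T₂ O) = T₂ O' := by
  simp [baseChange, T₂]

theorem baseChange_const {O' : Type*} [CommRing O'] (φ : O →+* O') (c : O) :
    baseChange φ (const O c) = const O' (φ c) := by
  simp [baseChange, const]

/-- `ζ − 1 ∣ p` for a primitive `p^{m+1}`-th root of unity in a domain (from `∏ (1 − μ) = Φ_{p^{m+1}}(1) = p`,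
tree `prod_one_sub_primitiveRoots_prime_pow`). [cite: Washington1997, Lemma 1.4 / Prop. 2.8] -/
theorem zeta_sub_one_dvd_prime {O' : Type*} [CommRing O'] [IsDomain O'] [hp : Fact p.Prime] (m : ℕ)
    {ζ : O'} (hζ : IsPrimitiveRoot ζ (p ^ (m + 1))) : (ζ - 1 : O') ∣ (p : O') := by
  have hprod := Summit.BirchSwinnertonDyer.BirchSwinnertonDyer.Theorems.EisensteinPrimesMazurMCOnX1RankZeroTameSeam.prod_one_sub_primitiveRoots_prime_pow
    (F := O') m hζ
  have hmem : ζ ∈ primitiveRoots (p ^ (m + 1)) O' :=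
    (mem_primitiveRoots (pow_pos hp.out.pos _)).mpr hζ
  have h1 : (1 - ζ : O') ∣ (p : O') := hprod ▸ Finset.dvd_prod_of_mem _ hmem
  have hneg : (ζ - 1 : O') = -(1 - ζ) := by ring
  rw [hneg]
  exact (neg_dvd).mpr h1

/-- **Blind spot, comb half (PROVED)**: `T₂ ∣ p` integrally on every comb line. -/
theorem blindSpot_comb [Fact p.Prime] : ThinCombDvdInt O p (T₂ O) (const O (p : O)) := by
  intro n
  refine ⟨n, le_rfl, fun O' _ _ _ ζ hζ => ?_⟩
  rw [baseChange_T₂, baseChange_const, map_natCast]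
  unfold LineDvdUpTo
  set I : Ideal (Λ₂ O') := Ideal.span ({T₂ O', combLine O' (ζ - 1)} : Set (Λ₂ O'))
  have hT : T₂ O' ∈ I := Ideal.subset_span (by simp)
  have hL : combLine O' (ζ - 1) ∈ I := Ideal.subset_span (by simp)
  -- `const (ζ − 1) = T₂ − combLine (ζ − 1)` lies in `I`
  have hc : const O' (ζ - 1) ∈ I := by
    have : const O' (ζ - 1) = T₂ O' - combLine O' (ζ - 1) := by
      simp [const, T₂, combLine, map_sub]
    rw [this]
    exact I.sub_mem hT hL
  obtain ⟨q, hq⟩ := zeta_sub_one_dvd_prime p (O' := O') _ hζ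
  have : const O' 1 * const O' (p : O') = const O' q * const O' (ζ - 1) := by
    rw [← map_mul, ← map_mul, one_mul, hq, mul_comm]
  rw [this]
  exact I.mul_mem_left _ hc

/-- **Blind spot, failure half (PROVED)**: `T₂ ∤ p^a · p` in `Λ₂(O)` whenever `p^{a+1} ≠ 0` in `O`. -/
theorem blindSpot_not_dvd (a : ℕ) (hp : ((p : O) ^ a * p) ≠ 0) :
    ¬ (T₂ O ∣ const O ((p : O) ^ a) * const O (p : O)) := by
  rintro ⟨q, hq⟩
  have h := congrArg (fun x : Λ₂ O => PowerSeries.constantCoeff (PowerSeries.constantCoeff x)) hq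
  simp [const, T₂] at h
  exact hp h

/-- The specialisation `T₂ ↦ 0` (kill the inner variable): `Λ₂(O) → O⟦T₁⟧`. -/
noncomputable def killT₂ : Λ₂ O →+* PowerSeries O := PowerSeries.map (PowerSeries.constantCoeff (R := O))

@[simp] theorem killT₂_T₂ : killT₂ O (T₂ O) = 0 := by simp [killT₂, T₂]

@[simp] theorem killT₂_T₁ : killT₂ O (T₁ O) = PowerSeries.X := by simp [killT₂, T₁]

/-- **Blind spot, reflection half (PROVED)**: `T₂` is never `ρ`-symmetric for a reflection `ρ`
(apply `T₂ ↦ 0` to `(1 + T₁)(1 + ρ T₂) = 1`: if `ρ T₂ ∼ T₂` this reads `1 + T₁ = 1`). -/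
theorem blindSpot_not_symmetric [Nontrivial O] {ρ : Λ₂ O ≃+* Λ₂ O} (hρ : IsReflection O ρ) :
    ¬ Associated (ρ (T₂ O)) (T₂ O) := by
  rintro ⟨u, hu⟩
  have hρT : ρ (T₂ O) = T₂ O * ↑u⁻¹ := (Units.eq_mul_inv_iff_mul_eq (c := u)).mpr hu
  have h := congrArg (killT₂ O) hρ.2.1
  rw [hρT] at h
  simp only [map_mul, map_add, map_one, killT₂_T₁, killT₂_T₂, zero_mul, add_zero, mul_one] at h
  -- `h : 1 + X = 1` in `O⟦T₁⟧`
  have h1 := congrArg (PowerSeries.coeff (R := O) 1) h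
  simp at h1

end Algebra

/-! ## §2 The assembly: rigidity + a comb package ⟹ the RATIONAL WALL shape (PROVED, abstract carriers)

The arithmetic enters only through the fields of `CombPackage` (NOTHING asserted): `G` = a generator of
`ch_{Λ₂}(X_{∅,0}(E/K̃_∞)) ⊗ O` (`O = R₀ = W(𝔽̄₃)`), `L₂` = Hida's 𝛉-dominant two-variable Rankin–Selberg
function of `(f_E, 𝛉^{(𝔭)})` in toric normalisation, `πac` = restriction to the anticyclotomic line,
`chAc` = `ch_Λ(X^{ac}_{∅,0}) ⊗ O`, `Lbdp` = the route's BDP frame `L`. Fields ↔ card items: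
`comb` = K2 (thin-comb supply: BF + 𝛉-dominant ERL + Λ-adic Kolyvagin bound at 3, per 3-power twist),
`symmL`, `compare` (and the existence of `L₂`) = K3, `symmG` = K4 (two-variable algebraic functional
equation), `control` = S2 (in cell: wi-82196/82197 + Greenberg no-pseudo-null; bsd-wall-ss brief v1.2). -/

section Assembly

variable {O : Type*} [CommRing O] {p : ℕ} {Λac : Type*} [CommRing Λac]

/-- The comb package for one curve (hypothesis structure; nothing asserted). -/
structure CombPackage (O : Type*) [CommRing O] (p : ℕ) (Λac : Type*) [CommRing Λac] where
  /-- the reflection `γ ↦ c γ⁻¹ c` on `Λ₂(O)` -/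
  ρ : Λ₂ O ≃+* Λ₂ O
  isReflection : IsReflection O ρ
  /-- generator of the two-variable characteristic ideal `ch_{Λ₂}(X_{∅,0}(E/K̃_∞))` -/
  G : Λ₂ O
  /-- the two-variable 𝛉-dominant `p`-adic `L`-function -/
  L₂ : Λ₂ O
  /-- K4: algebraic functional equation `ch(X_{∅,0})^{ι c} = ch(X_{∅,0})` -/
  symmG : Associated (ρ G) G
  /-- K3(iii): analytic functional equation with UNIT multiplier (Büyükboduk–Lei shape) -/
  symmL : Associated (ρ L₂) L₂
  /-- K2: thin-comb supply -/
  comb : ThinCombDvdRat O p G L₂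
  /-- restriction to the anticyclotomic line -/
  πac : Λ₂ O →+* Λac
  /-- `ch_Λ(X^{ac}_{∅,0})` -/
  chAc : Ideal Λac
  /-- S2: `p^k · πac(ch X₂) ⊆ ch X_ac` (control + relative Euler characteristic + no pseudo-null) -/
  control : ∃ k : ℕ, (p : Λac) ^ k * πac G ∈ chAc
  /-- the BDP frame on the anticyclotomic line -/
  Lbdp : Λac
  /-- K3(ii): `L₂|_{ac} ∼ L^{BDP}` up to a unit -/
  compare : Associated (πac L₂) Lbdp

/-- **Assembly (PROVED).** Thin-comb reflection rigidity + a comb package ⟹ the rational wall shape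
`∃ k, (p^k · L^{BDP}) ⊆ ch_Λ(X^{ac}_{∅,0})` (= `RatWall.AdditiveSplitIMCInclusionAtThreeRat` of memo v32
once the carriers are the route's; with `CombReflectionRigidityInt` + an integral comb, `k = k(control)`). -/
theorem CombPackage.ratWallShape (hrig : CombReflectionRigidityRat O p) (P : CombPackage O p Λac) :
    ∃ k : ℕ, Ideal.span {(p : Λac) ^ k * P.Lbdp} ≤ P.chAc := by
  obtain ⟨a, q, hq⟩ := hrig P.ρ P.isReflection P.G P.L₂ P.symmG P.symmL P.comb
  obtain ⟨k, hk⟩ := P.control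
  obtain ⟨u, hu⟩ := P.compare
  refine ⟨k + a, ?_⟩
  rw [Ideal.span_singleton_le_iff_mem]
  -- `p^a · πac L₂ = πac G · πac q`
  have h1 : (p : Λac) ^ a * P.πac P.L₂ = P.πac P.G * P.πac q := by
    have := congrArg P.πac hq
    rw [map_mul, map_mul] at this
    rw [← this]
    congr 1
    simp [const]
  have h2 : (p : Λac) ^ (k + a) * P.Lbdp = ((p : Λac) ^ k * P.πac P.G) * (P.πac q * ↑u) := by
    rw [← hu, pow_add]
    calc (p : Λac) ^ k * (p : Λac) ^ a * (P.πac P.L₂ * ↑u)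
        = (p : Λac) ^ k * ((p : Λac) ^ a * P.πac P.L₂) * ↑u := by ring
      _ = (p : Λac) ^ k * (P.πac P.G * P.πac q) * ↑u := by rw [h1]
      _ = ((p : Λac) ^ k * P.πac P.G) * (P.πac q * ↑u) := by ring
  rw [h2]
  exact P.chAc.mul_mem_right _ hk

end Assembly

end Summit.BirchSwinnertonDyer.BirchSwinnertonDyer.Cruxes.AdditiveSplitIMCInclusionAtThree.CombReflection
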